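import Summits.QuantumFields.YangMills.Theorems.BalabanUVNodesN11CondExpOfFibrewiseIdentity

/-!
# DAG node N11 — THE CHART READING FROM (3.23) POINTWISE IN THE KEPT FLUCTUATION VARIABLES: when a fibre chart's coordinates split as (kept `a` on `B_k(Λ^c_{k+1} ∩ Ω_{k+1})`,
# integrated `x`), the reading identity `∫ J ρ(Ψ) = R̃_{S₀}(y,·)` follows from ONE identity per `(v, a)` — the new small-field fluctuation integral performed, nothing else

HEADER — WORK-UNIT METADATA.  Cell `pub-ymgap`, YM-PLAN Track A (D-0062), seat `pub-ymgap-dag-n11-d` (g17; N11 [B14], s2), route `BalabanUVNodes`, item K1⁹ = stmt-QuantumFields-27364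
(helper lane, `--kind proof --supports 27364 --as helper`, count-neutral).  [I] = [Balaban1987RG1], [III] = [Balaban1988Convergent], [15] = [Balaban1985Variational].  Over 11a's
`Node00/TkOfRecord` (`zetaOp_apply`, `aOp_apply`: the generation's A-factor is the Lebesgue integral over the kept fluctuation variables on `sA_k`, `genDataOfRecord`,
`genDataOfRecord_laws`), this seat's g10 ∕ g15 measurability bookkeeping (`…TkOpMeasurable`, `…TStepBranchSumAtRecord13OfLaws.measurable_glueUpdate_baseCfg`,
`…TStepBranchSumOldIndex.update_succ_mem_admSSeq_succ`, `…TStepOldBranchGraphIntegrable.tkBranchOfRecord_nonneg`); sequel of `…N11FibrewiseIdentityOfFibreChart` (the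
frozen-`y` identity from a `y`-parametrised chart family with the READING `∫ J_y ρ_y(Ψ_y) dκ_y =ᵐ R̃_{S₀}(y,·)` displayed).

WHY THIS FILE.  The intrinsic value `R̃_{S₀}(y, v)` = `Σ_Y ζ_k(Ω^c_{k+1})(ω_{y,v}) · ∫ da w_k(Λ_{k+1}, Λ^c_{k+1}∩Ω_{k+1}, Y)(ω_{y,v}^a) · (𝐓_k(init s′,S₀)[W] Φ_{S₀∪Y})(ω_{y,v}^a)` is
ITSELF an integral over the KEPT fluctuation variables `a` (11a's `aOp_apply`; `ζ` and the bond set `sA_k` do not depend on `Y`).  Print's chart of the inside variables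
([I] §2, [15] (47)–(49)) has coordinates `A` on all of `B(Ω_{k+1})` = (kept `a` on `Ω_{k+1} ∖ Λ_{k+1}`) × (integrated `x` on `Λ_{k+1}`), and (3.16)–(3.23) PERFORM the `x`-integral at
fixed `a`: «∫ dx J·(old density∘chart) = ζ · χ · e^{−½⟨a,Δa⟩} · (𝐓_k e^{A_{k+1}})(a)» — Theorem 2's re-expansion.  So when the chart's reference splits as `dv ⊗ (da ⊗ τ(dx))`, the
reading identity of `…N11FibrewiseIdentityOfFibreChart` follows by Fubini over `a` from ONE POINTWISE IDENTITY per `(v, a)`; the only subtlety — exchanging `Σ_Y` and `∫ da`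
needs each summand integrable — is settled by nonnegativity (`w ≥ 0`, `𝐓_k[W]Φ ≥ 0` under the weight laws and `Φ ≥ 0`): the `ζ`-weighted sum is integrable because it is
a.e. the inner integral of an integrable function.

WHAT THIS FILE PROVES (0 `def`, 0 `sorry`, standard axioms).  §1 ★ `reading_of_keptSplit` (generic measurable spaces).  §2 ★★ `reading_of_keptSplit_at_record` (generic record
letters `(ν, M, g, p, W, Φ)`, one old branch, one frozen `y`: the READING of `…N11FibrewiseIdentityOfFibreChart` with `κ_y = da ⊗ τ` from the pointwise identity (hpt)).

HONEST FRAMING.  Helper lane of K1⁹; count-neutral; [folklore] measure theory (Fubini, finite sums of nonnegative integrands) + measurability bookkeeping by name; (hpt)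
DISPLAYED — it IS [III] (3.16)–(3.23) ∘ Thm 2 at fixed kept variables ([I] Thm 1 + [II] at the first step), NOT proved; NO chart constructed, NO Jacobian computed, NO Gaussian
integration performed; nothing of Bałaban asserted; N11 NOT discharged; K1⁹ NOT closed, no registered stub touched; counts unmoved (typed 28∕28 · discharged 5∕27 · A 5∕28).
One finite `𝕋⁴_{L^K}` programme at fixed `ε = L^{−K}` — NOT ℝ⁴, NOT OS, NOT a mass gap, NOT Clay.  No `sorry`, `axiom`, `def`, `instance`, `notation`.  Sources (SHAPE only):
[III] (2.18) p.257, (2.20)–(2.21) p.258, (3.1) p.264, (3.16)–(3.23) pp.268–270, Thm 2 p.263; [I] (0.4) p.253, §2 p.267; [15] (47)–(49) pp.287–288.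
-/

noncomputable section

open MeasureTheory ProbabilityTheory
open scoped ENNReal NNReal BigOperators

namespace Summit.QuantumFields.YangMills.Theorems.BalabanUVNodesN11ChartReadingOfKeptSplit

open Literature.MathematicalPhysics.QuantumFieldTheory.Balaban1983to89
open Literature.MathematicalPhysics.QuantumFieldTheory.Balaban1983to89.T4AveragingDisintegration
open BalabanUVNodesN11TkOpMeasurable (measurable_tkOp measurable_genOp_genDataOfRecord)
open BalabanUVNodesN11TStepBranchSumAtRecord13OfLaws (measurable_glueUpdate_baseCfg)
open BalabanUVNodesN11TStepBranchSumOldIndex (update_succ_mem_admSSeq_succ)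
open BalabanUVNodesN11TStepOldBranchGraphIntegrable (tkBranchOfRecord_nonneg)
open Node00 hiding SU
open Node00.Tk T4Continuum B14.Eq218Concrete
open B10Eq42TorusConstraint (bondsIn)
open T4AdjointCovariance (insA)

/-! ## §1  Generic: the reading of a kept ∕ integrated split -/

section Generic

variable {V A X : Type*} [MeasurableSpace V] [MeasurableSpace A] [MeasurableSpace X]

/-- ★ **READING OF A KEPT ∕ INTEGRATED SPLIT** (generic): `G` integrable on `μ₂ ⊗ (μA ⊗ τ)`, a finite family of nonnegative a.e.-strongly-measurable `g_i` on `μ₂ ⊗ μA`, and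
for a.e. `(v, a)` the pointwise identity `∫ G(v,(a,x)) dτ(x) = ζ(v) · Σ_i g_i(v,a)`; THEN `v ↦ ∫ G(v,·) d(μA ⊗ τ)` is a.e. `v ↦ Σ_i ζ(v) · ∫ g_i(v,a) dμA(a)` (Fubini over `a`;
where `ζ(v) ≠ 0` each nonnegative summand is integrable because the sum is; where `ζ(v) = 0` both sides vanish). [folklore] -/
theorem reading_of_keptSplit (μ₂ : Measure V) [SFinite μ₂] (μA : Measure A) [SFinite μA] (τ : Measure X) [SFinite τ]
    {G : V × (A × X) → ℝ} (hG : Integrable G (μ₂.prod (μA.prod τ)))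
    {ι : Type*} (Ys : Finset ι) {g : ι → V × A → ℝ} (hg0 : ∀ i ∈ Ys, ∀ q, 0 ≤ g i q)
    (hgm : ∀ i ∈ Ys, AEStronglyMeasurable (g i) (μ₂.prod μA))
    {ζ : V → ℝ}
    (hpt : ∀ᵐ q ∂(μ₂.prod μA), ∫ x, G (q.1, (q.2, x)) ∂τ = ζ q.1 * ∑ i ∈ Ys, g i q) :
    (fun v => ∫ r, G (v, r) ∂(μA.prod τ)) =ᵐ[μ₂] fun v => ∑ i ∈ Ys, ζ v * ∫ a, g i (v, a) ∂μA := by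
  have h1 := hG.prod_right_ae            -- ∀ᵐ v, Integrable (fun r => G (v, r)) (μA.prod τ)
  have h2 := Measure.ae_ae_of_ae_prod hpt -- ∀ᵐ v, ∀ᵐ a, ...
  have h3 : ∀ i ∈ Ys, ∀ᵐ v ∂μ₂, AEStronglyMeasurable (fun a => g i (v, a)) μA := fun i hi => (hgm i hi).prodMk_left
  have h3' : ∀ᵐ v ∂μ₂, ∀ i ∈ Ys, AEStronglyMeasurable (fun a => g i (v, a)) μA := (Filter.eventually_all_finset Ys).2 h3
  filter_upwards [h1, h2, h3'] with v hGv hptv hgmv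
  -- Fubini on the fibre over `v`
  rw [integral_prod _ hGv]
  have hI : Integrable (fun a => ∫ x, G (v, (a, x)) ∂τ) μA := hGv.integral_prod_left
  rw [integral_congr_ae hptv, integral_const_mul]
  by_cases hζ : ζ v = 0
  · simp [hζ]
  -- each nonnegative summand is integrable: dominated by the sum, which is `(ζ v)⁻¹ * ∫ G`
  have hsum : Integrable (fun a => ∑ i ∈ Ys, g i (v, a)) μA := by
    have := (hI.congr hptv).const_mul (ζ v)⁻¹
    refine this.congr (Filter.Eventually.of_forall fun a => ?_)
    simp only [← mul_assoc, inv_mul_cancel₀ hζ, one_mul]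
  have hint : ∀ i ∈ Ys, Integrable (fun a => g i (v, a)) μA := fun i hi =>
    hsum.mono' (hgmv i hi) (Filter.Eventually.of_forall fun a => by
      rw [Real.norm_eq_abs, abs_of_nonneg (hg0 i hi _)]
      exact Finset.single_le_sum (fun j hj => hg0 j hj (v, a)) hi)
  rw [integral_finsetSum _ hint, Finset.mul_sum]

end Generic

/-! ## §2  Record letters: the chart reading of `…N11FibrewiseIdentityOfFibreChart` from (3.23) pointwise in the kept fluctuation variables -/

section Record

variable {F : T4Family} {N : ℕ} [NeZero N]

/-- ★★ **THE CHART READING FROM A POINTWISE IDENTITY IN THE KEPT FLUCTUATION VARIABLES** (generic letters `(ν, M, g, p, W, Φ)`; one old branch `S₀`, one frozen `y`): if the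
fibre chart's coordinate space SPLITS as `(a, x)` — `a` = 11a's kept fluctuation variables on `sA_k = B_k(Λ^c_{k+1} ∩ Ω_{k+1})` with Lebesgue measure, `x ∈ X` the integrated
coordinates with an s-finite `τ` — `ρ` is integrable, `hpush` holds for `(dv ⊗ (da ⊗ τ), Ψ, J, S)`, and for a.e. `(v, a)` THE POINTWISE IDENTITY
`∫ J(v,a,x)·ρ(Ψ(v,a,x)) dτ(x) = ζ_k(Ω^c_{k+1})(ω_{y,v}) · Σ_Y w_k(…,Y)(ω_{y,v}^a)·(𝐓_k(init s′,S₀)[W]Φ_{S₀∪Y})(ω_{y,v}^a)` holds (`ω_{y,v}` = the glue insertion of the presented point,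
`ω^a` = `a` inserted at scale `k` on `sA_k`), then the chart integral over `(a, x)` IS the intrinsic reading `R̃_{S₀}(y,·)`, `dv`-a.e. (Fubini over `a`; the nonnegative
`Y`-summands are integrable because their `ζ`-weighted sum is; `ζ = 0` trivial).  This is the shape of print's (3.23): the NEW small-field fluctuation integral performed
POINTWISE in the kept variables. [cite: Balaban1988Convergent, (2.21) p.258, (3.16)–(3.23) pp.268–270; Balaban1987RG1, §2 p.267] -/
theorem reading_of_keptSplit_at_record (ν : Stage7Numerics) (M : ℕ) (g : ℕ → ℝ) (p : B12.RunParams) {k : ℕ}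
    {hdec : DecidableEq (PBond (F.P p.K) k)} {hdec' : DecidableEq (PBond (F.P p.K) (k + 1))}
    (s' : SeqOfRecord F ν M g p.K (k + 1)) {W : TkWeights F N (FluctV N) p.K} (hW : W.Laws)
    (hζm : ∀ j Y, Measurable (W.ζ j Y)) (hwm : ∀ j Λ' Y S, Measurable (W.w j Λ' Y S))
    (Φ : SFluct (F.P p.K) (FluctV N) → B15DeterminingSets.MSField (F.P p.K) (SU N) → ℝ) (hΦ0 : ∀ 𝔞 U, 0 ≤ Φ 𝔞 U)
    (hΦm : ∀ S ∈ admSOfRecord F ν M g p.K (k + 1) s',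
      Measurable fun ω : MultiCfg (F.P p.K) (SU N) (FluctV N) => Φ (S, fun j => (ω j).2) (fun j => (ω j).1))
    (S₀ : ℕ → Set (Site (F.P p.K) 0)) (h₀ : S₀ ∈ admSOfRecord F ν M g p.K k s'.init) (y : ↥(Set.toFinite (bondsIn k (s'.Ω (k + 1))ᶜ)).toFinset → SU N)
    {X : Type*} [MeasurableSpace X] (τ : Measure X) [SFinite τ]
    {ρ : ({b : PBond (F.P p.K) k // b ∉ (Set.toFinite (bondsIn k (s'.Ω (k + 1))ᶜ)).toFinset} → SU N) → ℝ} (hρ : Integrable ρ (Measure.pi fun _ : {b : PBond (F.P p.K) k // b ∉ (Set.toFinite (bondsIn k (s'.Ω (k + 1))ᶜ)).toFinset} => (HaarData.haar : Measure (SU N))))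
    {Ψ : ({c : PBond (F.P p.K) (k + 1) // c ∉ (Set.toFinite (bondsIn (k + 1) (s'.Ω (k + 1))ᶜ)).toFinset} → SU N) × ((↥(Set.toFinite (bondsIn k ((s'.Λ (k + 1))ᶜ ∩ s'.Ω (k + 1)))).toFinset → FluctV N) × X) → ({b : PBond (F.P p.K) k // b ∉ (Set.toFinite (bondsIn k (s'.Ω (k + 1))ᶜ)).toFinset} → SU N)} (hΨ : Measurable Ψ)
    {J : ({c : PBond (F.P p.K) (k + 1) // c ∉ (Set.toFinite (bondsIn (k + 1) (s'.Ω (k + 1))ᶜ)).toFinset} → SU N) × ((↥(Set.toFinite (bondsIn k ((s'.Λ (k + 1))ᶜ ∩ s'.Ω (k + 1)))).toFinset → FluctV N) × X) → ℝ≥0} (hJ : Measurable J) {Sc : Set ({b : PBond (F.P p.K) k // b ∉ (Set.toFinite (bondsIn k (s'.Ω (k + 1))ᶜ)).toFinset} → SU N)}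
    (hpush : (((Measure.pi fun _ : {c : PBond (F.P p.K) (k + 1) // c ∉ (Set.toFinite (bondsIn (k + 1) (s'.Ω (k + 1))ᶜ)).toFinset} => (HaarData.haar : Measure (SU N))).prod ((Measure.pi fun _ : ↥(Set.toFinite (bondsIn k ((s'.Λ (k + 1))ᶜ ∩ s'.Ω (k + 1)))).toFinset => (volume : Measure (FluctV N))).prod τ)).withDensity (fun z => (J z : ℝ≥0∞))).map Ψ = (Measure.pi fun _ : {b : PBond (F.P p.K) k // b ∉ (Set.toFinite (bondsIn k (s'.Ω (k + 1))ᶜ)).toFinset} => (HaarData.haar : Measure (SU N))).restrict Sc)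
    -- THE POINTWISE IDENTITY IN THE KEPT FLUCTUATION VARIABLES (print's (3.23), displayed)
    (hpt : ∀ᵐ q ∂((Measure.pi fun _ : {c : PBond (F.P p.K) (k + 1) // c ∉ (Set.toFinite (bondsIn (k + 1) (s'.Ω (k + 1))ᶜ)).toFinset} => (HaarData.haar : Measure (SU N))).prod (Measure.pi fun _ : ↥(Set.toFinite (bondsIn k ((s'.Λ (k + 1))ᶜ ∩ s'.Ω (k + 1)))).toFinset => (volume : Measure (FluctV N)))),
      ∫ x, (J (q.1, (q.2, x)) : ℝ) * ρ (Ψ (q.1, (q.2, x))) ∂τ =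
        W.ζ k (s'.Ω (k + 1))ᶜ (Function.update (baseCfg (k + 1) ((MeasurableEquiv.piEquivPiSubtypeProd (fun _ : PBond (F.P p.K) (k + 1) => SU N)
              (· ∈ (Set.toFinite (bondsIn (k + 1) (s'.Ω (k + 1))ᶜ)).toFinset)).symm (avgRestrOfRecord F N p.K k (Set.toFinite (bondsIn k (s'.Ω (k + 1))ᶜ)).toFinset
                (Set.toFinite (bondsIn (k + 1) (s'.Ω (k + 1))ᶜ)).toFinset y, q.1))) k
            (Function.updateFinset ((baseCfg (V := FluctV N) (k + 1) ((MeasurableEquiv.piEquivPiSubtypeProd (fun _ : PBond (F.P p.K) (k + 1) => SU N)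
              (· ∈ (Set.toFinite (bondsIn (k + 1) (s'.Ω (k + 1))ᶜ)).toFinset)).symm (avgRestrOfRecord F N p.K k (Set.toFinite (bondsIn k (s'.Ω (k + 1))ᶜ)).toFinset
                (Set.toFinite (bondsIn (k + 1) (s'.Ω (k + 1))ᶜ)).toFinset y, q.1))) k).1 (Set.toFinite (bondsIn k (s'.Ω (k + 1))ᶜ)).toFinset y,
              ((baseCfg (V := FluctV N) (k + 1) ((MeasurableEquiv.piEquivPiSubtypeProd (fun _ : PBond (F.P p.K) (k + 1) => SU N)
              (· ∈ (Set.toFinite (bondsIn (k + 1) (s'.Ω (k + 1))ᶜ)).toFinset)).symm (avgRestrOfRecord F N p.K k (Set.toFinite (bondsIn k (s'.Ω (k + 1))ᶜ)).toFinset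
                (Set.toFinite (bondsIn (k + 1) (s'.Ω (k + 1))ᶜ)).toFinset y, q.1))) k).2)) *
        ∑ Y ∈ (Set.toFinite {Y : Set (Site (F.P p.K) 0) | Y ∈ SClassOfRecord F ν g p.K (k + 1) ∧ Y ⊆ s'.Ω (k + 1) ∩ (s'.Λ (k + 1))ᶜ}).toFinset,
          ((genDataOfRecord F N (FluctV N) ν M g p.K W s' (Function.update S₀ (k + 1) Y) k).w
            (Function.update (Function.update (baseCfg (k + 1) ((MeasurableEquiv.piEquivPiSubtypeProd (fun _ : PBond (F.P p.K) (k + 1) => SU N)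
              (· ∈ (Set.toFinite (bondsIn (k + 1) (s'.Ω (k + 1))ᶜ)).toFinset)).symm (avgRestrOfRecord F N p.K k (Set.toFinite (bondsIn k (s'.Ω (k + 1))ᶜ)).toFinset
                (Set.toFinite (bondsIn (k + 1) (s'.Ω (k + 1))ᶜ)).toFinset y, q.1))) k
            (Function.updateFinset ((baseCfg (V := FluctV N) (k + 1) ((MeasurableEquiv.piEquivPiSubtypeProd (fun _ : PBond (F.P p.K) (k + 1) => SU N)
              (· ∈ (Set.toFinite (bondsIn (k + 1) (s'.Ω (k + 1))ᶜ)).toFinset)).symm (avgRestrOfRecord F N p.K k (Set.toFinite (bondsIn k (s'.Ω (k + 1))ᶜ)).toFinset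
                (Set.toFinite (bondsIn (k + 1) (s'.Ω (k + 1))ᶜ)).toFinset y, q.1))) k).1 (Set.toFinite (bondsIn k (s'.Ω (k + 1))ᶜ)).toFinset y,
              ((baseCfg (V := FluctV N) (k + 1) ((MeasurableEquiv.piEquivPiSubtypeProd (fun _ : PBond (F.P p.K) (k + 1) => SU N)
              (· ∈ (Set.toFinite (bondsIn (k + 1) (s'.Ω (k + 1))ᶜ)).toFinset)).symm (avgRestrOfRecord F N p.K k (Set.toFinite (bondsIn k (s'.Ω (k + 1))ᶜ)).toFinset
                (Set.toFinite (bondsIn (k + 1) (s'.Ω (k + 1))ᶜ)).toFinset y, q.1))) k).2)) k (insA (Set.toFinite (bondsIn k ((s'.Λ (k + 1))ᶜ ∩ s'.Ω (k + 1)))).toFinset q.2 ((Function.update (baseCfg (k + 1) ((MeasurableEquiv.piEquivPiSubtypeProd (fun _ : PBond (F.P p.K) (k + 1) => SU N)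
              (· ∈ (Set.toFinite (bondsIn (k + 1) (s'.Ω (k + 1))ᶜ)).toFinset)).symm (avgRestrOfRecord F N p.K k (Set.toFinite (bondsIn k (s'.Ω (k + 1))ᶜ)).toFinset
                (Set.toFinite (bondsIn (k + 1) (s'.Ω (k + 1))ᶜ)).toFinset y, q.1))) k
            (Function.updateFinset ((baseCfg (V := FluctV N) (k + 1) ((MeasurableEquiv.piEquivPiSubtypeProd (fun _ : PBond (F.P p.K) (k + 1) => SU N)
              (· ∈ (Set.toFinite (bondsIn (k + 1) (s'.Ω (k + 1))ᶜ)).toFinset)).symm (avgRestrOfRecord F N p.K k (Set.toFinite (bondsIn k (s'.Ω (k + 1))ᶜ)).toFinset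
                (Set.toFinite (bondsIn (k + 1) (s'.Ω (k + 1))ᶜ)).toFinset y, q.1))) k).1 (Set.toFinite (bondsIn k (s'.Ω (k + 1))ᶜ)).toFinset y,
              ((baseCfg (V := FluctV N) (k + 1) ((MeasurableEquiv.piEquivPiSubtypeProd (fun _ : PBond (F.P p.K) (k + 1) => SU N)
              (· ∈ (Set.toFinite (bondsIn (k + 1) (s'.Ω (k + 1))ᶜ)).toFinset)).symm (avgRestrOfRecord F N p.K k (Set.toFinite (bondsIn k (s'.Ω (k + 1))ᶜ)).toFinset
                (Set.toFinite (bondsIn (k + 1) (s'.Ω (k + 1))ᶜ)).toFinset y, q.1))) k).2)) k))) *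
          (tkBranchOfRecord F N (FluctV N) ν M g p.K W s'.init S₀ k
                (fun ω => Φ (Function.update S₀ (k + 1) Y, fun j => (ω j).2) (fun j => (ω j).1)))
            (Function.update (Function.update (baseCfg (k + 1) ((MeasurableEquiv.piEquivPiSubtypeProd (fun _ : PBond (F.P p.K) (k + 1) => SU N)
              (· ∈ (Set.toFinite (bondsIn (k + 1) (s'.Ω (k + 1))ᶜ)).toFinset)).symm (avgRestrOfRecord F N p.K k (Set.toFinite (bondsIn k (s'.Ω (k + 1))ᶜ)).toFinset
                (Set.toFinite (bondsIn (k + 1) (s'.Ω (k + 1))ᶜ)).toFinset y, q.1))) k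
            (Function.updateFinset ((baseCfg (V := FluctV N) (k + 1) ((MeasurableEquiv.piEquivPiSubtypeProd (fun _ : PBond (F.P p.K) (k + 1) => SU N)
              (· ∈ (Set.toFinite (bondsIn (k + 1) (s'.Ω (k + 1))ᶜ)).toFinset)).symm (avgRestrOfRecord F N p.K k (Set.toFinite (bondsIn k (s'.Ω (k + 1))ᶜ)).toFinset
                (Set.toFinite (bondsIn (k + 1) (s'.Ω (k + 1))ᶜ)).toFinset y, q.1))) k).1 (Set.toFinite (bondsIn k (s'.Ω (k + 1))ᶜ)).toFinset y,
              ((baseCfg (V := FluctV N) (k + 1) ((MeasurableEquiv.piEquivPiSubtypeProd (fun _ : PBond (F.P p.K) (k + 1) => SU N)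
              (· ∈ (Set.toFinite (bondsIn (k + 1) (s'.Ω (k + 1))ᶜ)).toFinset)).symm (avgRestrOfRecord F N p.K k (Set.toFinite (bondsIn k (s'.Ω (k + 1))ᶜ)).toFinset
                (Set.toFinite (bondsIn (k + 1) (s'.Ω (k + 1))ᶜ)).toFinset y, q.1))) k).2)) k (insA (Set.toFinite (bondsIn k ((s'.Λ (k + 1))ᶜ ∩ s'.Ω (k + 1)))).toFinset q.2 ((Function.update (baseCfg (k + 1) ((MeasurableEquiv.piEquivPiSubtypeProd (fun _ : PBond (F.P p.K) (k + 1) => SU N)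
              (· ∈ (Set.toFinite (bondsIn (k + 1) (s'.Ω (k + 1))ᶜ)).toFinset)).symm (avgRestrOfRecord F N p.K k (Set.toFinite (bondsIn k (s'.Ω (k + 1))ᶜ)).toFinset
                (Set.toFinite (bondsIn (k + 1) (s'.Ω (k + 1))ᶜ)).toFinset y, q.1))) k
            (Function.updateFinset ((baseCfg (V := FluctV N) (k + 1) ((MeasurableEquiv.piEquivPiSubtypeProd (fun _ : PBond (F.P p.K) (k + 1) => SU N)
              (· ∈ (Set.toFinite (bondsIn (k + 1) (s'.Ω (k + 1))ᶜ)).toFinset)).symm (avgRestrOfRecord F N p.K k (Set.toFinite (bondsIn k (s'.Ω (k + 1))ᶜ)).toFinset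
                (Set.toFinite (bondsIn (k + 1) (s'.Ω (k + 1))ᶜ)).toFinset y, q.1))) k).1 (Set.toFinite (bondsIn k (s'.Ω (k + 1))ᶜ)).toFinset y,
              ((baseCfg (V := FluctV N) (k + 1) ((MeasurableEquiv.piEquivPiSubtypeProd (fun _ : PBond (F.P p.K) (k + 1) => SU N)
              (· ∈ (Set.toFinite (bondsIn (k + 1) (s'.Ω (k + 1))ᶜ)).toFinset)).symm (avgRestrOfRecord F N p.K k (Set.toFinite (bondsIn k (s'.Ω (k + 1))ᶜ)).toFinset
                (Set.toFinite (bondsIn (k + 1) (s'.Ω (k + 1))ᶜ)).toFinset y, q.1))) k).2)) k))))) :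
    (fun v => ∫ r, (J (v, r) : ℝ) * ρ (Ψ (v, r)) ∂((Measure.pi fun _ : ↥(Set.toFinite (bondsIn k ((s'.Λ (k + 1))ᶜ ∩ s'.Ω (k + 1)))).toFinset => (volume : Measure (FluctV N))).prod τ)) =ᵐ[(Measure.pi fun _ : {c : PBond (F.P p.K) (k + 1) // c ∉ (Set.toFinite (bondsIn (k + 1) (s'.Ω (k + 1))ᶜ)).toFinset} => (HaarData.haar : Measure (SU N)))]
      fun v => ∑ Y ∈ (Set.toFinite {Y : Set (Site (F.P p.K) 0) | Y ∈ SClassOfRecord F ν g p.K (k + 1) ∧ Y ⊆ s'.Ω (k + 1) ∩ (s'.Λ (k + 1))ᶜ}).toFinset,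
        zetaOp (genDataOfRecord F N (FluctV N) ν M g p.K W s' (Function.update S₀ (k + 1) Y) k).ζ
          (aOp k (genDataOfRecord F N (FluctV N) ν M g p.K W s' (Function.update S₀ (k + 1) Y) k).sA (genDataOfRecord F N (FluctV N) ν M g p.K W s' (Function.update S₀ (k + 1) Y) k).w
            (tkBranchOfRecord F N (FluctV N) ν M g p.K W s'.init S₀ k
                (fun ω => Φ (Function.update S₀ (k + 1) Y, fun j => (ω j).2) (fun j => (ω j).1))))
          (Function.update (baseCfg (k + 1) ((MeasurableEquiv.piEquivPiSubtypeProd (fun _ : PBond (F.P p.K) (k + 1) => SU N)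
              (· ∈ (Set.toFinite (bondsIn (k + 1) (s'.Ω (k + 1))ᶜ)).toFinset)).symm (avgRestrOfRecord F N p.K k (Set.toFinite (bondsIn k (s'.Ω (k + 1))ᶜ)).toFinset
                (Set.toFinite (bondsIn (k + 1) (s'.Ω (k + 1))ᶜ)).toFinset y, v))) k
            (Function.updateFinset ((baseCfg (V := FluctV N) (k + 1) ((MeasurableEquiv.piEquivPiSubtypeProd (fun _ : PBond (F.P p.K) (k + 1) => SU N)
              (· ∈ (Set.toFinite (bondsIn (k + 1) (s'.Ω (k + 1))ᶜ)).toFinset)).symm (avgRestrOfRecord F N p.K k (Set.toFinite (bondsIn k (s'.Ω (k + 1))ᶜ)).toFinset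
                (Set.toFinite (bondsIn (k + 1) (s'.Ω (k + 1))ᶜ)).toFinset y, v))) k).1 (Set.toFinite (bondsIn k (s'.Ω (k + 1))ᶜ)).toFinset y,
              ((baseCfg (V := FluctV N) (k + 1) ((MeasurableEquiv.piEquivPiSubtypeProd (fun _ : PBond (F.P p.K) (k + 1) => SU N)
              (· ∈ (Set.toFinite (bondsIn (k + 1) (s'.Ω (k + 1))ᶜ)).toFinset)).symm (avgRestrOfRecord F N p.K k (Set.toFinite (bondsIn k (s'.Ω (k + 1))ᶜ)).toFinset
                (Set.toFinite (bondsIn (k + 1) (s'.Ω (k + 1))ᶜ)).toFinset y, v))) k).2)) := by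
  -- integrability of the charted integrand from `hpush`
  have hI0 : Integrable ρ ((Measure.pi fun _ : {b : PBond (F.P p.K) k // b ∉ (Set.toFinite (bondsIn k (s'.Ω (k + 1))ᶜ)).toFinset} => (HaarData.haar : Measure (SU N))).restrict Sc) := hρ.mono_measure Measure.restrict_le_self
  rw [← hpush] at hI0
  have hG : Integrable (fun z : ({c : PBond (F.P p.K) (k + 1) // c ∉ (Set.toFinite (bondsIn (k + 1) (s'.Ω (k + 1))ᶜ)).toFinset} → SU N) × ((↥(Set.toFinite (bondsIn k ((s'.Λ (k + 1))ᶜ ∩ s'.Ω (k + 1)))).toFinset → FluctV N) × X) => (J z : ℝ) * ρ (Ψ z)) ((Measure.pi fun _ : {c : PBond (F.P p.K) (k + 1) // c ∉ (Set.toFinite (bondsIn (k + 1) (s'.Ω (k + 1))ᶜ)).toFinset} => (HaarData.haar : Measure (SU N))).prod ((Measure.pi fun _ : ↥(Set.toFinite (bondsIn k ((s'.Λ (k + 1))ᶜ ∩ s'.Ω (k + 1)))).toFinset => (volume : Measure (FluctV N))).prod τ)) := by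
    have h1 := (integrable_map_measure hI0.aestronglyMeasurable hΨ.aemeasurable).1 hI0
    have h2 := (integrable_withDensity_iff_integrable_smul hJ).1 h1
    simpa only [NNReal.smul_def, smul_eq_mul, Function.comp_apply] using h2
  -- measurability of the glue insertion in `v` and of the `a`-insertion
  have hΩ : Measurable fun v : ({c : PBond (F.P p.K) (k + 1) // c ∉ (Set.toFinite (bondsIn (k + 1) (s'.Ω (k + 1))ᶜ)).toFinset} → SU N) => (Function.update (baseCfg (k + 1) ((MeasurableEquiv.piEquivPiSubtypeProd (fun _ : PBond (F.P p.K) (k + 1) => SU N)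
              (· ∈ (Set.toFinite (bondsIn (k + 1) (s'.Ω (k + 1))ᶜ)).toFinset)).symm (avgRestrOfRecord F N p.K k (Set.toFinite (bondsIn k (s'.Ω (k + 1))ᶜ)).toFinset
                (Set.toFinite (bondsIn (k + 1) (s'.Ω (k + 1))ᶜ)).toFinset y, v))) k
            (Function.updateFinset ((baseCfg (V := FluctV N) (k + 1) ((MeasurableEquiv.piEquivPiSubtypeProd (fun _ : PBond (F.P p.K) (k + 1) => SU N)
              (· ∈ (Set.toFinite (bondsIn (k + 1) (s'.Ω (k + 1))ᶜ)).toFinset)).symm (avgRestrOfRecord F N p.K k (Set.toFinite (bondsIn k (s'.Ω (k + 1))ᶜ)).toFinset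
                (Set.toFinite (bondsIn (k + 1) (s'.Ω (k + 1))ᶜ)).toFinset y, v))) k).1 (Set.toFinite (bondsIn k (s'.Ω (k + 1))ᶜ)).toFinset y,
              ((baseCfg (V := FluctV N) (k + 1) ((MeasurableEquiv.piEquivPiSubtypeProd (fun _ : PBond (F.P p.K) (k + 1) => SU N)
              (· ∈ (Set.toFinite (bondsIn (k + 1) (s'.Ω (k + 1))ᶜ)).toFinset)).symm (avgRestrOfRecord F N p.K k (Set.toFinite (bondsIn k (s'.Ω (k + 1))ᶜ)).toFinset
                (Set.toFinite (bondsIn (k + 1) (s'.Ω (k + 1))ᶜ)).toFinset y, v))) k).2)) :=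
    (measurable_glueUpdate_baseCfg F N (FluctV N) p.K k (Set.toFinite (bondsIn k (s'.Ω (k + 1))ᶜ)).toFinset (Set.toFinite (bondsIn (k + 1) (s'.Ω (k + 1))ᶜ)).toFinset).comp ((measurable_const.prodMk measurable_id).prodMk measurable_const)
  have hk : Measurable (fun z : MultiCfg (F.P p.K) (SU N) (FluctV N) × (↥(Set.toFinite (bondsIn k ((s'.Λ (k + 1))ᶜ ∩ s'.Ω (k + 1)))).toFinset → FluctV N) => z.1 k) := (measurable_pi_apply k).comp measurable_fst
  have hins : Measurable (fun z : MultiCfg (F.P p.K) (SU N) (FluctV N) × (↥(Set.toFinite (bondsIn k ((s'.Λ (k + 1))ᶜ ∩ s'.Ω (k + 1)))).toFinset → FluctV N) => Function.update z.1 k (insA (Set.toFinite (bondsIn k ((s'.Λ (k + 1))ᶜ ∩ s'.Ω (k + 1)))).toFinset z.2 (z.1 k))) :=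
    measurable_update'.comp (measurable_fst.prodMk
      ((measurable_fst.comp hk).prodMk (measurable_updateFinset'.comp ((measurable_snd.comp hk).prodMk measurable_snd))))
  have hΩa : Measurable fun q : ({c : PBond (F.P p.K) (k + 1) // c ∉ (Set.toFinite (bondsIn (k + 1) (s'.Ω (k + 1))ᶜ)).toFinset} → SU N) × (↥(Set.toFinite (bondsIn k ((s'.Λ (k + 1))ᶜ ∩ s'.Ω (k + 1)))).toFinset → FluctV N) => (Function.update (Function.update (baseCfg (k + 1) ((MeasurableEquiv.piEquivPiSubtypeProd (fun _ : PBond (F.P p.K) (k + 1) => SU N)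
              (· ∈ (Set.toFinite (bondsIn (k + 1) (s'.Ω (k + 1))ᶜ)).toFinset)).symm (avgRestrOfRecord F N p.K k (Set.toFinite (bondsIn k (s'.Ω (k + 1))ᶜ)).toFinset
                (Set.toFinite (bondsIn (k + 1) (s'.Ω (k + 1))ᶜ)).toFinset y, q.1))) k
            (Function.updateFinset ((baseCfg (V := FluctV N) (k + 1) ((MeasurableEquiv.piEquivPiSubtypeProd (fun _ : PBond (F.P p.K) (k + 1) => SU N)
              (· ∈ (Set.toFinite (bondsIn (k + 1) (s'.Ω (k + 1))ᶜ)).toFinset)).symm (avgRestrOfRecord F N p.K k (Set.toFinite (bondsIn k (s'.Ω (k + 1))ᶜ)).toFinset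
                (Set.toFinite (bondsIn (k + 1) (s'.Ω (k + 1))ᶜ)).toFinset y, q.1))) k).1 (Set.toFinite (bondsIn k (s'.Ω (k + 1))ᶜ)).toFinset y,
              ((baseCfg (V := FluctV N) (k + 1) ((MeasurableEquiv.piEquivPiSubtypeProd (fun _ : PBond (F.P p.K) (k + 1) => SU N)
              (· ∈ (Set.toFinite (bondsIn (k + 1) (s'.Ω (k + 1))ᶜ)).toFinset)).symm (avgRestrOfRecord F N p.K k (Set.toFinite (bondsIn k (s'.Ω (k + 1))ᶜ)).toFinset
                (Set.toFinite (bondsIn (k + 1) (s'.Ω (k + 1))ᶜ)).toFinset y, q.1))) k).2)) k (insA (Set.toFinite (bondsIn k ((s'.Λ (k + 1))ᶜ ∩ s'.Ω (k + 1)))).toFinset q.2 ((Function.update (baseCfg (k + 1) ((MeasurableEquiv.piEquivPiSubtypeProd (fun _ : PBond (F.P p.K) (k + 1) => SU N)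
              (· ∈ (Set.toFinite (bondsIn (k + 1) (s'.Ω (k + 1))ᶜ)).toFinset)).symm (avgRestrOfRecord F N p.K k (Set.toFinite (bondsIn k (s'.Ω (k + 1))ᶜ)).toFinset
                (Set.toFinite (bondsIn (k + 1) (s'.Ω (k + 1))ᶜ)).toFinset y, q.1))) k
            (Function.updateFinset ((baseCfg (V := FluctV N) (k + 1) ((MeasurableEquiv.piEquivPiSubtypeProd (fun _ : PBond (F.P p.K) (k + 1) => SU N)
              (· ∈ (Set.toFinite (bondsIn (k + 1) (s'.Ω (k + 1))ᶜ)).toFinset)).symm (avgRestrOfRecord F N p.K k (Set.toFinite (bondsIn k (s'.Ω (k + 1))ᶜ)).toFinset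
                (Set.toFinite (bondsIn (k + 1) (s'.Ω (k + 1))ᶜ)).toFinset y, q.1))) k).1 (Set.toFinite (bondsIn k (s'.Ω (k + 1))ᶜ)).toFinset y,
              ((baseCfg (V := FluctV N) (k + 1) ((MeasurableEquiv.piEquivPiSubtypeProd (fun _ : PBond (F.P p.K) (k + 1) => SU N)
              (· ∈ (Set.toFinite (bondsIn (k + 1) (s'.Ω (k + 1))ᶜ)).toFinset)).symm (avgRestrOfRecord F N p.K k (Set.toFinite (bondsIn k (s'.Ω (k + 1))ᶜ)).toFinset
                (Set.toFinite (bondsIn (k + 1) (s'.Ω (k + 1))ᶜ)).toFinset y, q.1))) k).2)) k))) :=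
    hins.comp ((hΩ.comp measurable_fst).prodMk measurable_snd)
  -- the `Y`-summands are measurable and nonnegative
  have hgm : ∀ Y ∈ (Set.toFinite {Y : Set (Site (F.P p.K) 0) | Y ∈ SClassOfRecord F ν g p.K (k + 1) ∧ Y ⊆ s'.Ω (k + 1) ∩ (s'.Λ (k + 1))ᶜ}).toFinset, AEStronglyMeasurable (fun q : ({c : PBond (F.P p.K) (k + 1) // c ∉ (Set.toFinite (bondsIn (k + 1) (s'.Ω (k + 1))ᶜ)).toFinset} → SU N) × (↥(Set.toFinite (bondsIn k ((s'.Λ (k + 1))ᶜ ∩ s'.Ω (k + 1)))).toFinset → FluctV N) =>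
      (genDataOfRecord F N (FluctV N) ν M g p.K W s' (Function.update S₀ (k + 1) Y) k).w
            (Function.update (Function.update (baseCfg (k + 1) ((MeasurableEquiv.piEquivPiSubtypeProd (fun _ : PBond (F.P p.K) (k + 1) => SU N)
              (· ∈ (Set.toFinite (bondsIn (k + 1) (s'.Ω (k + 1))ᶜ)).toFinset)).symm (avgRestrOfRecord F N p.K k (Set.toFinite (bondsIn k (s'.Ω (k + 1))ᶜ)).toFinset
                (Set.toFinite (bondsIn (k + 1) (s'.Ω (k + 1))ᶜ)).toFinset y, q.1))) k
            (Function.updateFinset ((baseCfg (V := FluctV N) (k + 1) ((MeasurableEquiv.piEquivPiSubtypeProd (fun _ : PBond (F.P p.K) (k + 1) => SU N)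
              (· ∈ (Set.toFinite (bondsIn (k + 1) (s'.Ω (k + 1))ᶜ)).toFinset)).symm (avgRestrOfRecord F N p.K k (Set.toFinite (bondsIn k (s'.Ω (k + 1))ᶜ)).toFinset
                (Set.toFinite (bondsIn (k + 1) (s'.Ω (k + 1))ᶜ)).toFinset y, q.1))) k).1 (Set.toFinite (bondsIn k (s'.Ω (k + 1))ᶜ)).toFinset y,
              ((baseCfg (V := FluctV N) (k + 1) ((MeasurableEquiv.piEquivPiSubtypeProd (fun _ : PBond (F.P p.K) (k + 1) => SU N)
              (· ∈ (Set.toFinite (bondsIn (k + 1) (s'.Ω (k + 1))ᶜ)).toFinset)).symm (avgRestrOfRecord F N p.K k (Set.toFinite (bondsIn k (s'.Ω (k + 1))ᶜ)).toFinset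
                (Set.toFinite (bondsIn (k + 1) (s'.Ω (k + 1))ᶜ)).toFinset y, q.1))) k).2)) k (insA (Set.toFinite (bondsIn k ((s'.Λ (k + 1))ᶜ ∩ s'.Ω (k + 1)))).toFinset q.2 ((Function.update (baseCfg (k + 1) ((MeasurableEquiv.piEquivPiSubtypeProd (fun _ : PBond (F.P p.K) (k + 1) => SU N)
              (· ∈ (Set.toFinite (bondsIn (k + 1) (s'.Ω (k + 1))ᶜ)).toFinset)).symm (avgRestrOfRecord F N p.K k (Set.toFinite (bondsIn k (s'.Ω (k + 1))ᶜ)).toFinset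
                (Set.toFinite (bondsIn (k + 1) (s'.Ω (k + 1))ᶜ)).toFinset y, q.1))) k
            (Function.updateFinset ((baseCfg (V := FluctV N) (k + 1) ((MeasurableEquiv.piEquivPiSubtypeProd (fun _ : PBond (F.P p.K) (k + 1) => SU N)
              (· ∈ (Set.toFinite (bondsIn (k + 1) (s'.Ω (k + 1))ᶜ)).toFinset)).symm (avgRestrOfRecord F N p.K k (Set.toFinite (bondsIn k (s'.Ω (k + 1))ᶜ)).toFinset
                (Set.toFinite (bondsIn (k + 1) (s'.Ω (k + 1))ᶜ)).toFinset y, q.1))) k).1 (Set.toFinite (bondsIn k (s'.Ω (k + 1))ᶜ)).toFinset y,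
              ((baseCfg (V := FluctV N) (k + 1) ((MeasurableEquiv.piEquivPiSubtypeProd (fun _ : PBond (F.P p.K) (k + 1) => SU N)
              (· ∈ (Set.toFinite (bondsIn (k + 1) (s'.Ω (k + 1))ᶜ)).toFinset)).symm (avgRestrOfRecord F N p.K k (Set.toFinite (bondsIn k (s'.Ω (k + 1))ᶜ)).toFinset
                (Set.toFinite (bondsIn (k + 1) (s'.Ω (k + 1))ᶜ)).toFinset y, q.1))) k).2)) k))) *
          (tkBranchOfRecord F N (FluctV N) ν M g p.K W s'.init S₀ k
                (fun ω => Φ (Function.update S₀ (k + 1) Y, fun j => (ω j).2) (fun j => (ω j).1)))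
            (Function.update (Function.update (baseCfg (k + 1) ((MeasurableEquiv.piEquivPiSubtypeProd (fun _ : PBond (F.P p.K) (k + 1) => SU N)
              (· ∈ (Set.toFinite (bondsIn (k + 1) (s'.Ω (k + 1))ᶜ)).toFinset)).symm (avgRestrOfRecord F N p.K k (Set.toFinite (bondsIn k (s'.Ω (k + 1))ᶜ)).toFinset
                (Set.toFinite (bondsIn (k + 1) (s'.Ω (k + 1))ᶜ)).toFinset y, q.1))) k
            (Function.updateFinset ((baseCfg (V := FluctV N) (k + 1) ((MeasurableEquiv.piEquivPiSubtypeProd (fun _ : PBond (F.P p.K) (k + 1) => SU N)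
              (· ∈ (Set.toFinite (bondsIn (k + 1) (s'.Ω (k + 1))ᶜ)).toFinset)).symm (avgRestrOfRecord F N p.K k (Set.toFinite (bondsIn k (s'.Ω (k + 1))ᶜ)).toFinset
                (Set.toFinite (bondsIn (k + 1) (s'.Ω (k + 1))ᶜ)).toFinset y, q.1))) k).1 (Set.toFinite (bondsIn k (s'.Ω (k + 1))ᶜ)).toFinset y,
              ((baseCfg (V := FluctV N) (k + 1) ((MeasurableEquiv.piEquivPiSubtypeProd (fun _ : PBond (F.P p.K) (k + 1) => SU N)
              (· ∈ (Set.toFinite (bondsIn (k + 1) (s'.Ω (k + 1))ᶜ)).toFinset)).symm (avgRestrOfRecord F N p.K k (Set.toFinite (bondsIn k (s'.Ω (k + 1))ᶜ)).toFinset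
                (Set.toFinite (bondsIn (k + 1) (s'.Ω (k + 1))ᶜ)).toFinset y, q.1))) k).2)) k (insA (Set.toFinite (bondsIn k ((s'.Λ (k + 1))ᶜ ∩ s'.Ω (k + 1)))).toFinset q.2 ((Function.update (baseCfg (k + 1) ((MeasurableEquiv.piEquivPiSubtypeProd (fun _ : PBond (F.P p.K) (k + 1) => SU N)
              (· ∈ (Set.toFinite (bondsIn (k + 1) (s'.Ω (k + 1))ᶜ)).toFinset)).symm (avgRestrOfRecord F N p.K k (Set.toFinite (bondsIn k (s'.Ω (k + 1))ᶜ)).toFinset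
                (Set.toFinite (bondsIn (k + 1) (s'.Ω (k + 1))ᶜ)).toFinset y, q.1))) k
            (Function.updateFinset ((baseCfg (V := FluctV N) (k + 1) ((MeasurableEquiv.piEquivPiSubtypeProd (fun _ : PBond (F.P p.K) (k + 1) => SU N)
              (· ∈ (Set.toFinite (bondsIn (k + 1) (s'.Ω (k + 1))ᶜ)).toFinset)).symm (avgRestrOfRecord F N p.K k (Set.toFinite (bondsIn k (s'.Ω (k + 1))ᶜ)).toFinset
                (Set.toFinite (bondsIn (k + 1) (s'.Ω (k + 1))ᶜ)).toFinset y, q.1))) k).1 (Set.toFinite (bondsIn k (s'.Ω (k + 1))ᶜ)).toFinset y,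
              ((baseCfg (V := FluctV N) (k + 1) ((MeasurableEquiv.piEquivPiSubtypeProd (fun _ : PBond (F.P p.K) (k + 1) => SU N)
              (· ∈ (Set.toFinite (bondsIn (k + 1) (s'.Ω (k + 1))ᶜ)).toFinset)).symm (avgRestrOfRecord F N p.K k (Set.toFinite (bondsIn k (s'.Ω (k + 1))ᶜ)).toFinset
                (Set.toFinite (bondsIn (k + 1) (s'.Ω (k + 1))ᶜ)).toFinset y, q.1))) k).2)) k)))) ((Measure.pi fun _ : {c : PBond (F.P p.K) (k + 1) // c ∉ (Set.toFinite (bondsIn (k + 1) (s'.Ω (k + 1))ᶜ)).toFinset} => (HaarData.haar : Measure (SU N))).prod (Measure.pi fun _ : ↥(Set.toFinite (bondsIn k ((s'.Λ (k + 1))ᶜ ∩ s'.Ω (k + 1)))).toFinset => (volume : Measure (FluctV N)))) := by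
    intro Y hY
    rw [Set.Finite.mem_toFinset] at hY
    have hmem : Function.update S₀ (k + 1) Y ∈ admSOfRecord F ν M g p.K (k + 1) s' := update_succ_mem_admSSeq_succ _ s' h₀ hY.1 hY.2
    have hT : Measurable (tkBranchOfRecord F N (FluctV N) ν M g p.K W s'.init S₀ k
                (fun ω => Φ (Function.update S₀ (k + 1) Y, fun j => (ω j).2) (fun j => (ω j).1))) := by
      unfold tkBranchOfRecord
      exact measurable_tkOp _ (fun j Ψ' hΨ' => measurable_genOp_genDataOfRecord F N (FluctV N) ν M g p.K W s'.init S₀ j (hζm j _) (hwm j _ _ _) hΨ') k (hΦm _ hmem)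
    exact (((hwm k _ _ _).mul hT).comp hΩa).aestronglyMeasurable
  have hg0 : ∀ Y ∈ (Set.toFinite {Y : Set (Site (F.P p.K) 0) | Y ∈ SClassOfRecord F ν g p.K (k + 1) ∧ Y ⊆ s'.Ω (k + 1) ∩ (s'.Λ (k + 1))ᶜ}).toFinset, ∀ q : ({c : PBond (F.P p.K) (k + 1) // c ∉ (Set.toFinite (bondsIn (k + 1) (s'.Ω (k + 1))ᶜ)).toFinset} → SU N) × (↥(Set.toFinite (bondsIn k ((s'.Λ (k + 1))ᶜ ∩ s'.Ω (k + 1)))).toFinset → FluctV N), 0 ≤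
      (genDataOfRecord F N (FluctV N) ν M g p.K W s' (Function.update S₀ (k + 1) Y) k).w
            (Function.update (Function.update (baseCfg (k + 1) ((MeasurableEquiv.piEquivPiSubtypeProd (fun _ : PBond (F.P p.K) (k + 1) => SU N)
              (· ∈ (Set.toFinite (bondsIn (k + 1) (s'.Ω (k + 1))ᶜ)).toFinset)).symm (avgRestrOfRecord F N p.K k (Set.toFinite (bondsIn k (s'.Ω (k + 1))ᶜ)).toFinset
                (Set.toFinite (bondsIn (k + 1) (s'.Ω (k + 1))ᶜ)).toFinset y, q.1))) k
            (Function.updateFinset ((baseCfg (V := FluctV N) (k + 1) ((MeasurableEquiv.piEquivPiSubtypeProd (fun _ : PBond (F.P p.K) (k + 1) => SU N)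
              (· ∈ (Set.toFinite (bondsIn (k + 1) (s'.Ω (k + 1))ᶜ)).toFinset)).symm (avgRestrOfRecord F N p.K k (Set.toFinite (bondsIn k (s'.Ω (k + 1))ᶜ)).toFinset
                (Set.toFinite (bondsIn (k + 1) (s'.Ω (k + 1))ᶜ)).toFinset y, q.1))) k).1 (Set.toFinite (bondsIn k (s'.Ω (k + 1))ᶜ)).toFinset y,
              ((baseCfg (V := FluctV N) (k + 1) ((MeasurableEquiv.piEquivPiSubtypeProd (fun _ : PBond (F.P p.K) (k + 1) => SU N)
              (· ∈ (Set.toFinite (bondsIn (k + 1) (s'.Ω (k + 1))ᶜ)).toFinset)).symm (avgRestrOfRecord F N p.K k (Set.toFinite (bondsIn k (s'.Ω (k + 1))ᶜ)).toFinset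
                (Set.toFinite (bondsIn (k + 1) (s'.Ω (k + 1))ᶜ)).toFinset y, q.1))) k).2)) k (insA (Set.toFinite (bondsIn k ((s'.Λ (k + 1))ᶜ ∩ s'.Ω (k + 1)))).toFinset q.2 ((Function.update (baseCfg (k + 1) ((MeasurableEquiv.piEquivPiSubtypeProd (fun _ : PBond (F.P p.K) (k + 1) => SU N)
              (· ∈ (Set.toFinite (bondsIn (k + 1) (s'.Ω (k + 1))ᶜ)).toFinset)).symm (avgRestrOfRecord F N p.K k (Set.toFinite (bondsIn k (s'.Ω (k + 1))ᶜ)).toFinset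
                (Set.toFinite (bondsIn (k + 1) (s'.Ω (k + 1))ᶜ)).toFinset y, q.1))) k
            (Function.updateFinset ((baseCfg (V := FluctV N) (k + 1) ((MeasurableEquiv.piEquivPiSubtypeProd (fun _ : PBond (F.P p.K) (k + 1) => SU N)
              (· ∈ (Set.toFinite (bondsIn (k + 1) (s'.Ω (k + 1))ᶜ)).toFinset)).symm (avgRestrOfRecord F N p.K k (Set.toFinite (bondsIn k (s'.Ω (k + 1))ᶜ)).toFinset
                (Set.toFinite (bondsIn (k + 1) (s'.Ω (k + 1))ᶜ)).toFinset y, q.1))) k).1 (Set.toFinite (bondsIn k (s'.Ω (k + 1))ᶜ)).toFinset y,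
              ((baseCfg (V := FluctV N) (k + 1) ((MeasurableEquiv.piEquivPiSubtypeProd (fun _ : PBond (F.P p.K) (k + 1) => SU N)
              (· ∈ (Set.toFinite (bondsIn (k + 1) (s'.Ω (k + 1))ᶜ)).toFinset)).symm (avgRestrOfRecord F N p.K k (Set.toFinite (bondsIn k (s'.Ω (k + 1))ᶜ)).toFinset
                (Set.toFinite (bondsIn (k + 1) (s'.Ω (k + 1))ᶜ)).toFinset y, q.1))) k).2)) k))) *
          (tkBranchOfRecord F N (FluctV N) ν M g p.K W s'.init S₀ k
                (fun ω => Φ (Function.update S₀ (k + 1) Y, fun j => (ω j).2) (fun j => (ω j).1)))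
            (Function.update (Function.update (baseCfg (k + 1) ((MeasurableEquiv.piEquivPiSubtypeProd (fun _ : PBond (F.P p.K) (k + 1) => SU N)
              (· ∈ (Set.toFinite (bondsIn (k + 1) (s'.Ω (k + 1))ᶜ)).toFinset)).symm (avgRestrOfRecord F N p.K k (Set.toFinite (bondsIn k (s'.Ω (k + 1))ᶜ)).toFinset
                (Set.toFinite (bondsIn (k + 1) (s'.Ω (k + 1))ᶜ)).toFinset y, q.1))) k
            (Function.updateFinset ((baseCfg (V := FluctV N) (k + 1) ((MeasurableEquiv.piEquivPiSubtypeProd (fun _ : PBond (F.P p.K) (k + 1) => SU N)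
              (· ∈ (Set.toFinite (bondsIn (k + 1) (s'.Ω (k + 1))ᶜ)).toFinset)).symm (avgRestrOfRecord F N p.K k (Set.toFinite (bondsIn k (s'.Ω (k + 1))ᶜ)).toFinset
                (Set.toFinite (bondsIn (k + 1) (s'.Ω (k + 1))ᶜ)).toFinset y, q.1))) k).1 (Set.toFinite (bondsIn k (s'.Ω (k + 1))ᶜ)).toFinset y,
              ((baseCfg (V := FluctV N) (k + 1) ((MeasurableEquiv.piEquivPiSubtypeProd (fun _ : PBond (F.P p.K) (k + 1) => SU N)
              (· ∈ (Set.toFinite (bondsIn (k + 1) (s'.Ω (k + 1))ᶜ)).toFinset)).symm (avgRestrOfRecord F N p.K k (Set.toFinite (bondsIn k (s'.Ω (k + 1))ᶜ)).toFinset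
                (Set.toFinite (bondsIn (k + 1) (s'.Ω (k + 1))ᶜ)).toFinset y, q.1))) k).2)) k (insA (Set.toFinite (bondsIn k ((s'.Λ (k + 1))ᶜ ∩ s'.Ω (k + 1)))).toFinset q.2 ((Function.update (baseCfg (k + 1) ((MeasurableEquiv.piEquivPiSubtypeProd (fun _ : PBond (F.P p.K) (k + 1) => SU N)
              (· ∈ (Set.toFinite (bondsIn (k + 1) (s'.Ω (k + 1))ᶜ)).toFinset)).symm (avgRestrOfRecord F N p.K k (Set.toFinite (bondsIn k (s'.Ω (k + 1))ᶜ)).toFinset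
                (Set.toFinite (bondsIn (k + 1) (s'.Ω (k + 1))ᶜ)).toFinset y, q.1))) k
            (Function.updateFinset ((baseCfg (V := FluctV N) (k + 1) ((MeasurableEquiv.piEquivPiSubtypeProd (fun _ : PBond (F.P p.K) (k + 1) => SU N)
              (· ∈ (Set.toFinite (bondsIn (k + 1) (s'.Ω (k + 1))ᶜ)).toFinset)).symm (avgRestrOfRecord F N p.K k (Set.toFinite (bondsIn k (s'.Ω (k + 1))ᶜ)).toFinset
                (Set.toFinite (bondsIn (k + 1) (s'.Ω (k + 1))ᶜ)).toFinset y, q.1))) k).1 (Set.toFinite (bondsIn k (s'.Ω (k + 1))ᶜ)).toFinset y,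
              ((baseCfg (V := FluctV N) (k + 1) ((MeasurableEquiv.piEquivPiSubtypeProd (fun _ : PBond (F.P p.K) (k + 1) => SU N)
              (· ∈ (Set.toFinite (bondsIn (k + 1) (s'.Ω (k + 1))ᶜ)).toFinset)).symm (avgRestrOfRecord F N p.K k (Set.toFinite (bondsIn k (s'.Ω (k + 1))ᶜ)).toFinset
                (Set.toFinite (bondsIn (k + 1) (s'.Ω (k + 1))ᶜ)).toFinset y, q.1))) k).2)) k))) := fun Y _ q =>
    mul_nonneg ((genDataOfRecord_laws F N (FluctV N) ν M g p.K hW s' (Function.update S₀ (k + 1) Y) k).w_nonneg _)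
      (tkBranchOfRecord_nonneg ν M g p.K hW s'.init S₀ k (fun ω => hΦ0 _ _) _)
  have key := reading_of_keptSplit (Measure.pi fun _ : {c : PBond (F.P p.K) (k + 1) // c ∉ (Set.toFinite (bondsIn (k + 1) (s'.Ω (k + 1))ᶜ)).toFinset} => (HaarData.haar : Measure (SU N))) (Measure.pi fun _ : ↥(Set.toFinite (bondsIn k ((s'.Λ (k + 1))ᶜ ∩ s'.Ω (k + 1)))).toFinset => (volume : Measure (FluctV N))) τ hG (Set.toFinite {Y : Set (Site (F.P p.K) 0) | Y ∈ SClassOfRecord F ν g p.K (k + 1) ∧ Y ⊆ s'.Ω (k + 1) ∩ (s'.Λ (k + 1))ᶜ}).toFinset hg0 hgm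
    (ζ := fun v => W.ζ k (s'.Ω (k + 1))ᶜ (Function.update (baseCfg (k + 1) ((MeasurableEquiv.piEquivPiSubtypeProd (fun _ : PBond (F.P p.K) (k + 1) => SU N)
              (· ∈ (Set.toFinite (bondsIn (k + 1) (s'.Ω (k + 1))ᶜ)).toFinset)).symm (avgRestrOfRecord F N p.K k (Set.toFinite (bondsIn k (s'.Ω (k + 1))ᶜ)).toFinset
                (Set.toFinite (bondsIn (k + 1) (s'.Ω (k + 1))ᶜ)).toFinset y, v))) k
            (Function.updateFinset ((baseCfg (V := FluctV N) (k + 1) ((MeasurableEquiv.piEquivPiSubtypeProd (fun _ : PBond (F.P p.K) (k + 1) => SU N)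
              (· ∈ (Set.toFinite (bondsIn (k + 1) (s'.Ω (k + 1))ᶜ)).toFinset)).symm (avgRestrOfRecord F N p.K k (Set.toFinite (bondsIn k (s'.Ω (k + 1))ᶜ)).toFinset
                (Set.toFinite (bondsIn (k + 1) (s'.Ω (k + 1))ᶜ)).toFinset y, v))) k).1 (Set.toFinite (bondsIn k (s'.Ω (k + 1))ᶜ)).toFinset y,
              ((baseCfg (V := FluctV N) (k + 1) ((MeasurableEquiv.piEquivPiSubtypeProd (fun _ : PBond (F.P p.K) (k + 1) => SU N)
              (· ∈ (Set.toFinite (bondsIn (k + 1) (s'.Ω (k + 1))ᶜ)).toFinset)).symm (avgRestrOfRecord F N p.K k (Set.toFinite (bondsIn k (s'.Ω (k + 1))ᶜ)).toFinset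
                (Set.toFinite (bondsIn (k + 1) (s'.Ω (k + 1))ᶜ)).toFinset y, v))) k).2))) hpt
  refine key.trans (Filter.Eventually.of_forall fun v => ?_)
  simp only [zetaOp_apply, aOp_apply]
  rfl

end Record

end Summit.QuantumFields.YangMills.Theorems.BalabanUVNodesN11ChartReadingOfKeptSplit

end
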